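import Summits.QuantumFields.YangMills.Theorems.ColdStartUniversalityLatticeLangevinMarkovProperty
import HarnessLib

/-!
# Route `ColdStartUniversality` (fixed-cut-off SZZ dynamics): ★★★ FINITE-DIMENSIONAL DISTRIBUTIONS OF STRONG SOLUTIONS —
# the Markov chain of THE transition kernels; uniqueness in law AS PROCESSES

Helper file (seat `ym-line-csu-p1`, g33; `--supports stmt-QuantumFields-24809`).  Iterating the Markov property of file 44
(`integral_mul_comp_add_eq_integral_mul_transition`): for the SU(2) lattice Langevin (Shen–Zhu–Zhu) dynamics at any coupling, every Markov kernel
family `κ` realising the transition laws, EVERY strong solution `U` from a deterministic start `x` on ANY probability space, every list of time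
INCREMENTS and bounded measurable observables `(t₁,f₁), …, (t_n,f_n)`, every lattice time `s` and every bounded `σ(W_u : u ≤ s)`-measurable `Z`:

  `E[Z · f₁(U_(s+t₁)) · f₂(U_(s+t₁+t₂)) ⋯ f_n(U_(s+t₁+⋯+t_n))] = E[Z · (K_(t₁) f₁ K_(t₂) f₂ ⋯ K_(t_n) f_n 1)(U_s)]`,
  `(K_t f h)(y) := ∫ f(z) h(z) κ_t(y, dz)`                                  (`integral_mul_foldr_comp_eq_integral_mul_foldr_transition`),

both sides written as `List.foldr`s (no new definition).  Consequences: the finite-dimensional distributions of a strong solution are those of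
the Markov chain with kernels `κ_(t_i)` started at `x` (`integral_foldr_comp_eq_foldr_transition`), hence ★★★ UNIQUENESS IN LAW AS PROCESSES: two
strong solutions from the same start on any two probability spaces have the same finite-dimensional distributions
(`integral_foldr_comp_eq_of_solutions`; the one-time statement is `lawUnique_of_start`, the two-time law is `map_pair_eq_compProd`).
THEOREMS ONLY, no definition, no sorry; [folklore] / Revuz–Yor III (1.5)-type statements.  HONEST FRAMING: fixed cut-off; structural plumbing;
`UniformColdStartMixing` (24809) is NOT restated; no crux, rung or summit statement is proved; the Yang–Mills mass gap is NOT proved.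
-/

set_option autoImplicit false

noncomputable section

namespace Summit.QuantumFields.YangMills.Theorems.ColdStartUniversality

open MeasureTheory ProbabilityTheory Filter Topology
open scoped NNReal ENNReal BigOperators
open Literature Literature.Probability.Process Literature.MathematicalPhysics.QuantumFieldTheory
open Literature.MathematicalPhysics.QuantumLattice (fundamentalRep fundamentalLatticeRep continuous_fundamentalRep)

variable {L : ℕ} [NeZero L]

/-! ## §1. The iterated kernel observable `K_(t₁) f₁ ⋯ K_(t_n) f_n 1`: measurability and boundedness -/

omit [NeZero L] in
/-- The iterated kernel observable of a list of (time increment, bounded measurable observable) pairs is measurable. [folklore] -/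
theorem measurable_foldr_transition
    (κ : ℝ≥0 → Kernel (GaugeConfig 3 L (Matrix.specialUnitaryGroup (Fin 2) ℂ))
      (GaugeConfig 3 L (Matrix.specialUnitaryGroup (Fin 2) ℂ))) [∀ t, IsMarkovKernel (κ t)] :
    ∀ (l : List (ℝ≥0 × (GaugeConfig 3 L (Matrix.specialUnitaryGroup (Fin 2) ℂ) → ℝ))), (∀ p ∈ l, Measurable p.2) →
      Measurable (l.foldr (fun p acc => fun y => ∫ z, p.2 z * acc z ∂(κ p.1 y))
        (fun _ : GaugeConfig 3 L (Matrix.specialUnitaryGroup (Fin 2) ℂ) => (1 : ℝ)))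
  | [], _ => measurable_const
  | p :: l, h => by
    rw [List.foldr_cons]
    have ih := measurable_foldr_transition κ l (fun q hq => h q (List.mem_cons_of_mem _ hq))
    have hp : Measurable p.2 := h p List.mem_cons_self
    exact ((hp.mul ih).stronglyMeasurable.integral_kernel (κ := κ p.1)).measurable

omit [NeZero L] in
/-- The iterated kernel observable of a list of bounded measurable observables is bounded. [folklore] -/
theorem exists_abs_foldr_transition_le
    (κ : ℝ≥0 → Kernel (GaugeConfig 3 L (Matrix.specialUnitaryGroup (Fin 2) ℂ))
      (GaugeConfig 3 L (Matrix.specialUnitaryGroup (Fin 2) ℂ))) [∀ t, IsMarkovKernel (κ t)] :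
    ∀ (l : List (ℝ≥0 × (GaugeConfig 3 L (Matrix.specialUnitaryGroup (Fin 2) ℂ) → ℝ))), (∀ p ∈ l, ∃ C : ℝ, ∀ z, |p.2 z| ≤ C) →
      ∃ C : ℝ, ∀ y, |(l.foldr (fun p acc => fun y => ∫ z, p.2 z * acc z ∂(κ p.1 y))
        (fun _ : GaugeConfig 3 L (Matrix.specialUnitaryGroup (Fin 2) ℂ) => (1 : ℝ))) y| ≤ C
  | [], _ => ⟨1, fun y => by simp⟩
  | p :: l, h => by
    obtain ⟨Cl, hCl⟩ := exists_abs_foldr_transition_le κ l (fun q hq => h q (List.mem_cons_of_mem _ hq))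
    obtain ⟨Cp, hCp⟩ := h p List.mem_cons_self
    refine ⟨Cp * Cl, fun y => ?_⟩
    rw [List.foldr_cons]
    have hb : ∀ z, |p.2 z * (l.foldr (fun p acc => fun y => ∫ z, p.2 z * acc z ∂(κ p.1 y))
        (fun _ : GaugeConfig 3 L (Matrix.specialUnitaryGroup (Fin 2) ℂ) => (1 : ℝ))) z| ≤ Cp * Cl := fun z => by
      rw [abs_mul]
      exact mul_le_mul (hCp z) (hCl z) (abs_nonneg _) ((abs_nonneg _).trans (hCp z))
    have hh := norm_integral_le_of_norm_le_const (μ := κ p.1 y) (C := Cp * Cl)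
      (f := fun z => p.2 z * (l.foldr (fun p acc => fun y => ∫ z, p.2 z * acc z ∂(κ p.1 y))
        (fun _ : GaugeConfig 3 L (Matrix.specialUnitaryGroup (Fin 2) ℂ) => (1 : ℝ))) z)
      (Eventually.of_forall fun z => by rw [Real.norm_eq_abs]; exact hb z)
    simpa [Real.norm_eq_abs] using hh

/-! ## §2. The finite-dimensional Markov property -/

/-- ★★★ **Finite-dimensional Markov property of strong solutions.**  For every strong solution `U` from a deterministic start on any space,
every list `l = [(t₁,f₁), …, (t_n,f_n)]` of time increments and bounded measurable observables, every `s` and every bounded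
`σ(W_u : u ≤ s)`-measurable `Z`:
`E[Z · f₁(U_(s+t₁)) ⋯ f_n(U_(s+t₁+⋯+t_n))] = E[Z · (K_(t₁) f₁ ⋯ K_(t_n) f_n 1)(U_s)]`, `(K_t f h)(y) = ∫ f h dκ_t(y)`
(induction on the list: the Markov property of file 44 at time `s` for the observable `f₁ · (K_(t₂) f₂ ⋯ 1)`, after the induction hypothesis
at time `s + t₁` with the `𝓕_(s+t₁)`-measurable weight `Z · f₁(U_(s+t₁))`). [cite: RevuzYor1999, Ch. III Prop. (1.4)–(1.5)] -/
theorem integral_mul_foldr_comp_eq_integral_mul_foldr_transition (β' : ℝ)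
    (κ : ℝ≥0 → Kernel (GaugeConfig 3 L (Matrix.specialUnitaryGroup (Fin 2) ℂ))
      (GaugeConfig 3 L (Matrix.specialUnitaryGroup (Fin 2) ℂ))) [∀ t, IsMarkovKernel (κ t)]
    (hreal : ∀ (t : ℝ≥0) (x : GaugeConfig 3 L (Matrix.specialUnitaryGroup (Fin 2) ℂ))
        (Ω : Type) [MeasurableSpace Ω] (P : Measure Ω) [IsProbabilityMeasure P]
        (W : ℝ≥0 → Ω → (Edge 3 L × NoiseIdx 2 → ℝ)) (hW : IsFlatBrownian W P)
        (U : ℝ≥0 → Ω → GaugeConfig 3 L (Matrix.specialUnitaryGroup (Fin 2) ℂ)),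
        (∀ ω, U 0 ω = x) →
        (latticeLangevinDynamics (fundamentalLatticeRep 2) β').IsSolution (fundamentalRep (Fin 2))
          hW.natFiltration P W U →
        κ t x = P.map (U t))
    (x : GaugeConfig 3 L (Matrix.specialUnitaryGroup (Fin 2) ℂ))
    {Ω : Type} [MeasurableSpace Ω] {P : Measure Ω} [IsProbabilityMeasure P]
    {W : ℝ≥0 → Ω → (Edge 3 L × NoiseIdx 2 → ℝ)} (hW : IsFlatBrownian W P)
    {U : ℝ≥0 → Ω → GaugeConfig 3 L (Matrix.specialUnitaryGroup (Fin 2) ℂ)} (hU0 : ∀ ω, U 0 ω = x)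
    (hU : (latticeLangevinDynamics (fundamentalLatticeRep 2) β').IsSolution (fundamentalRep (Fin 2)) hW.natFiltration P W U) :
    ∀ (l : List (ℝ≥0 × (GaugeConfig 3 L (Matrix.specialUnitaryGroup (Fin 2) ℂ) → ℝ))),
      (∀ p ∈ l, Measurable p.2) → (∀ p ∈ l, ∃ C : ℝ, ∀ z, |p.2 z| ≤ C) →
      ∀ (s : ℝ≥0) {Z : Ω → ℝ}, Measurable[hW.natFiltration s] Z → ∀ {CZ : ℝ}, (∀ ω, |Z ω| ≤ CZ) →
      ∫ ω, Z ω * (l.foldr (fun p acc => fun u => p.2 (U (u + p.1) ω) * acc (u + p.1)) (fun _ : ℝ≥0 => (1 : ℝ))) s ∂P =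
        ∫ ω, Z ω * (l.foldr (fun p acc => fun y => ∫ z, p.2 z * acc z ∂(κ p.1 y))
          (fun _ : GaugeConfig 3 L (Matrix.specialUnitaryGroup (Fin 2) ℂ) => (1 : ℝ))) (U s ω) ∂P
  | [], _, _, s, Z, _, CZ, _ => by simp
  | p :: l, hm, hb, s, Z, hZ, CZ, hZb => by
    have hmU : ∀ u : ℝ≥0, Measurable (U u) := fun u => (hU.adapted u).mono (hW.natFiltration.le u) le_rfl
    have hml : ∀ q ∈ l, Measurable q.2 := fun q hq => hm q (List.mem_cons_of_mem _ hq)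
    have hbl : ∀ q ∈ l, ∃ C : ℝ, ∀ z, |q.2 z| ≤ C := fun q hq => hb q (List.mem_cons_of_mem _ hq)
    have hp : Measurable p.2 := hm p List.mem_cons_self
    obtain ⟨Cp, hCp⟩ := hb p List.mem_cons_self
    -- the weight `Z · f₁(U_(s+t₁))` is `𝓕_(s+t₁)`-measurable and bounded
    have hZ' : Measurable[hW.natFiltration (s + p.1)] fun ω => Z ω * p.2 (U (s + p.1) ω) :=
      (hZ.mono (hW.natFiltration.mono le_self_add) le_rfl).mul (hp.comp (hU.adapted (s + p.1)))
    have hZ'b : ∀ ω, |Z ω * p.2 (U (s + p.1) ω)| ≤ CZ * Cp := fun ω => by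
      rw [abs_mul]; exact mul_le_mul (hZb ω) (hCp _) (abs_nonneg _) ((abs_nonneg _).trans (hZb ω))
    have ih := integral_mul_foldr_comp_eq_integral_mul_foldr_transition β' κ hreal x hW hU0 hU l hml hbl (s + p.1) hZ' hZ'b
    -- the observable `f₁ · (K_(t₂) f₂ ⋯ 1)` is bounded measurable
    set Kl := l.foldr (fun p acc => fun y => ∫ z, p.2 z * acc z ∂(κ p.1 y))
      (fun _ : GaugeConfig 3 L (Matrix.specialUnitaryGroup (Fin 2) ℂ) => (1 : ℝ)) with hKl
    have hKlm : Measurable Kl := measurable_foldr_transition κ l hml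
    obtain ⟨Cl, hCl⟩ := exists_abs_foldr_transition_le κ l hbl
    have hGm : Measurable fun z => p.2 z * Kl z := hp.mul hKlm
    have hGb : ∀ z, |p.2 z * Kl z| ≤ Cp * Cl := fun z => by
      rw [abs_mul]; exact mul_le_mul (hCp z) (hCl z) (abs_nonneg _) ((abs_nonneg _).trans (hCp z))
    have hM := integral_mul_comp_add_eq_integral_mul_transition β' κ hreal x hW hU0 hU s p.1 hZ hZb hGm hGb
    simp only [List.foldr_cons]
    calc ∫ ω, Z ω * (p.2 (U (s + p.1) ω) *
          (l.foldr (fun p acc => fun u => p.2 (U (u + p.1) ω) * acc (u + p.1)) (fun _ : ℝ≥0 => (1 : ℝ))) (s + p.1)) ∂P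
        = ∫ ω, (Z ω * p.2 (U (s + p.1) ω)) *
          (l.foldr (fun p acc => fun u => p.2 (U (u + p.1) ω) * acc (u + p.1)) (fun _ : ℝ≥0 => (1 : ℝ))) (s + p.1) ∂P :=
          integral_congr_ae (ae_of_all _ fun ω => by ring)
      _ = ∫ ω, (Z ω * p.2 (U (s + p.1) ω)) * Kl (U (s + p.1) ω) ∂P := ih
      _ = ∫ ω, Z ω * (p.2 (U (s + p.1) ω) * Kl (U (s + p.1) ω)) ∂P := integral_congr_ae (ae_of_all _ fun ω => by ring)
      _ = ∫ ω, Z ω * (∫ z, p.2 z * Kl z ∂(κ p.1 (U s ω))) ∂P := hM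

/-- ★★★ **The finite-dimensional distributions of a strong solution are those of the Markov chain of THE kernels started at `x`**:
`E[f₁(U_(t₁)) f₂(U_(t₁+t₂)) ⋯ f_n(U_(t₁+⋯+t_n))] = (K_(t₁) f₁ ⋯ K_(t_n) f_n 1)(x)`. [cite: RevuzYor1999, Ch. III Prop. (1.4)–(1.5)] -/
theorem integral_foldr_comp_eq_foldr_transition (β' : ℝ)
    (κ : ℝ≥0 → Kernel (GaugeConfig 3 L (Matrix.specialUnitaryGroup (Fin 2) ℂ))
      (GaugeConfig 3 L (Matrix.specialUnitaryGroup (Fin 2) ℂ))) [∀ t, IsMarkovKernel (κ t)]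
    (hreal : ∀ (t : ℝ≥0) (x : GaugeConfig 3 L (Matrix.specialUnitaryGroup (Fin 2) ℂ))
        (Ω : Type) [MeasurableSpace Ω] (P : Measure Ω) [IsProbabilityMeasure P]
        (W : ℝ≥0 → Ω → (Edge 3 L × NoiseIdx 2 → ℝ)) (hW : IsFlatBrownian W P)
        (U : ℝ≥0 → Ω → GaugeConfig 3 L (Matrix.specialUnitaryGroup (Fin 2) ℂ)),
        (∀ ω, U 0 ω = x) →
        (latticeLangevinDynamics (fundamentalLatticeRep 2) β').IsSolution (fundamentalRep (Fin 2))
          hW.natFiltration P W U →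
        κ t x = P.map (U t))
    (x : GaugeConfig 3 L (Matrix.specialUnitaryGroup (Fin 2) ℂ))
    {Ω : Type} [MeasurableSpace Ω] {P : Measure Ω} [IsProbabilityMeasure P]
    {W : ℝ≥0 → Ω → (Edge 3 L × NoiseIdx 2 → ℝ)} (hW : IsFlatBrownian W P)
    {U : ℝ≥0 → Ω → GaugeConfig 3 L (Matrix.specialUnitaryGroup (Fin 2) ℂ)} (hU0 : ∀ ω, U 0 ω = x)
    (hU : (latticeLangevinDynamics (fundamentalLatticeRep 2) β').IsSolution (fundamentalRep (Fin 2)) hW.natFiltration P W U)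
    (l : List (ℝ≥0 × (GaugeConfig 3 L (Matrix.specialUnitaryGroup (Fin 2) ℂ) → ℝ)))
    (hm : ∀ p ∈ l, Measurable p.2) (hb : ∀ p ∈ l, ∃ C : ℝ, ∀ z, |p.2 z| ≤ C) :
    ∫ ω, (l.foldr (fun p acc => fun u => p.2 (U (u + p.1) ω) * acc (u + p.1)) (fun _ : ℝ≥0 => (1 : ℝ))) 0 ∂P =
      (l.foldr (fun p acc => fun y => ∫ z, p.2 z * acc z ∂(κ p.1 y))
        (fun _ : GaugeConfig 3 L (Matrix.specialUnitaryGroup (Fin 2) ℂ) => (1 : ℝ))) x := by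
  have h := integral_mul_foldr_comp_eq_integral_mul_foldr_transition β' κ hreal x hW hU0 hU l hm hb 0
    (measurable_const (a := (1 : ℝ))) (fun _ => le_rfl)
  simp only [one_mul, hU0, integral_const, probReal_univ, smul_eq_mul] at h
  exact h

/-! ## §3. Uniqueness in law as processes -/

/-- ★★★ **Uniqueness in law AS PROCESSES**: two strong solutions of the SU(2) SZZ dynamics from the same deterministic start, on ANY two
probability spaces with flat Brownian drivers, have the same finite-dimensional distributions — for every list of time increments and bounded
measurable observables, `E[f₁(U_(t₁)) ⋯ f_n(U_(t₁+⋯+t_n))] = E'[f₁(U'_(t₁)) ⋯ f_n(U'_(t₁+⋯+t_n))]` (the one-time case is `lawUnique_of_start`).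
[cite: RevuzYor1999, Ch. IX Thm (1.7)] -/
theorem integral_foldr_comp_eq_of_solutions (β' : ℝ)
    (x : GaugeConfig 3 L (Matrix.specialUnitaryGroup (Fin 2) ℂ))
    {Ω : Type} [MeasurableSpace Ω] {P : Measure Ω} [IsProbabilityMeasure P]
    {W : ℝ≥0 → Ω → (Edge 3 L × NoiseIdx 2 → ℝ)} (hW : IsFlatBrownian W P)
    {U : ℝ≥0 → Ω → GaugeConfig 3 L (Matrix.specialUnitaryGroup (Fin 2) ℂ)} (hU0 : ∀ ω, U 0 ω = x)
    (hU : (latticeLangevinDynamics (fundamentalLatticeRep 2) β').IsSolution (fundamentalRep (Fin 2)) hW.natFiltration P W U)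
    {Ω' : Type} [MeasurableSpace Ω'] {P' : Measure Ω'} [IsProbabilityMeasure P']
    {W' : ℝ≥0 → Ω' → (Edge 3 L × NoiseIdx 2 → ℝ)} (hW' : IsFlatBrownian W' P')
    {U' : ℝ≥0 → Ω' → GaugeConfig 3 L (Matrix.specialUnitaryGroup (Fin 2) ℂ)} (hU'0 : ∀ ω, U' 0 ω = x)
    (hU' : (latticeLangevinDynamics (fundamentalLatticeRep 2) β').IsSolution (fundamentalRep (Fin 2)) hW'.natFiltration P' W' U')
    (l : List (ℝ≥0 × (GaugeConfig 3 L (Matrix.specialUnitaryGroup (Fin 2) ℂ) → ℝ)))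
    (hm : ∀ p ∈ l, Measurable p.2) (hb : ∀ p ∈ l, ∃ C : ℝ, ∀ z, |p.2 z| ≤ C) :
    ∫ ω, (l.foldr (fun p acc => fun u => p.2 (U (u + p.1) ω) * acc (u + p.1)) (fun _ : ℝ≥0 => (1 : ℝ))) 0 ∂P =
      ∫ ω, (l.foldr (fun p acc => fun u => p.2 (U' (u + p.1) ω) * acc (u + p.1)) (fun _ : ℝ≥0 => (1 : ℝ))) 0 ∂P' := by
  classical
  obtain ⟨κ, hκM, -, hreal⟩ := exists_transitionKernel L β'
  haveI := hκM
  rw [integral_foldr_comp_eq_foldr_transition β' κ hreal x hW hU0 hU l hm hb,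
    integral_foldr_comp_eq_foldr_transition β' κ hreal x hW' hU'0 hU' l hm hb]

/-- **Three-time example** (the list `[(t₁,f₁), (t₂,f₂), (t₃,f₃)]` unfolded): along every strong solution from `x` on any space,
`E[f₁(U_(t₁))·f₂(U_(t₁+t₂))·f₃(U_(t₁+t₂+t₃))] = ∫ f₁(y₁) ∫ f₂(y₂) ∫ f₃(y₃) κ_(t₃)(y₂,dy₃) κ_(t₂)(y₁,dy₂) κ_(t₁)(x,dy₁)`. [folklore] -/
theorem integral_threeTime_eq_transition (β' : ℝ)
    (κ : ℝ≥0 → Kernel (GaugeConfig 3 L (Matrix.specialUnitaryGroup (Fin 2) ℂ))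
      (GaugeConfig 3 L (Matrix.specialUnitaryGroup (Fin 2) ℂ))) [∀ t, IsMarkovKernel (κ t)]
    (hreal : ∀ (t : ℝ≥0) (x : GaugeConfig 3 L (Matrix.specialUnitaryGroup (Fin 2) ℂ))
        (Ω : Type) [MeasurableSpace Ω] (P : Measure Ω) [IsProbabilityMeasure P]
        (W : ℝ≥0 → Ω → (Edge 3 L × NoiseIdx 2 → ℝ)) (hW : IsFlatBrownian W P)
        (U : ℝ≥0 → Ω → GaugeConfig 3 L (Matrix.specialUnitaryGroup (Fin 2) ℂ)),
        (∀ ω, U 0 ω = x) →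
        (latticeLangevinDynamics (fundamentalLatticeRep 2) β').IsSolution (fundamentalRep (Fin 2))
          hW.natFiltration P W U →
        κ t x = P.map (U t))
    (x : GaugeConfig 3 L (Matrix.specialUnitaryGroup (Fin 2) ℂ))
    {Ω : Type} [MeasurableSpace Ω] {P : Measure Ω} [IsProbabilityMeasure P]
    {W : ℝ≥0 → Ω → (Edge 3 L × NoiseIdx 2 → ℝ)} (hW : IsFlatBrownian W P)
    {U : ℝ≥0 → Ω → GaugeConfig 3 L (Matrix.specialUnitaryGroup (Fin 2) ℂ)} (hU0 : ∀ ω, U 0 ω = x)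
    (hU : (latticeLangevinDynamics (fundamentalLatticeRep 2) β').IsSolution (fundamentalRep (Fin 2)) hW.natFiltration P W U)
    (t₁ t₂ t₃ : ℝ≥0) {f₁ f₂ f₃ : GaugeConfig 3 L (Matrix.specialUnitaryGroup (Fin 2) ℂ) → ℝ}
    (h₁ : Measurable f₁) (h₂ : Measurable f₂) (h₃ : Measurable f₃) {C₁ C₂ C₃ : ℝ}
    (hb₁ : ∀ z, |f₁ z| ≤ C₁) (hb₂ : ∀ z, |f₂ z| ≤ C₂) (hb₃ : ∀ z, |f₃ z| ≤ C₃) :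
    ∫ ω, f₁ (U t₁ ω) * f₂ (U (t₁ + t₂) ω) * f₃ (U (t₁ + t₂ + t₃) ω) ∂P =
      ∫ y₁, f₁ y₁ * (∫ y₂, f₂ y₂ * (∫ y₃, f₃ y₃ ∂(κ t₃ y₂)) ∂(κ t₂ y₁)) ∂(κ t₁ x) := by
  have h := integral_foldr_comp_eq_foldr_transition β' κ hreal x hW hU0 hU [(t₁, f₁), (t₂, f₂), (t₃, f₃)]
    (by
      intro p hp
      simp only [List.mem_cons, List.not_mem_nil, or_false] at hp
      rcases hp with rfl | rfl | rfl
      exacts [h₁, h₂, h₃])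
    (by
      intro p hp
      simp only [List.mem_cons, List.not_mem_nil, or_false] at hp
      rcases hp with rfl | rfl | rfl
      exacts [⟨C₁, hb₁⟩, ⟨C₂, hb₂⟩, ⟨C₃, hb₃⟩])
  simp only [List.foldr_cons, List.foldr_nil, mul_one, zero_add] at h
  simpa [mul_assoc] using h

end Summit.QuantumFields.YangMills.Theorems.ColdStartUniversality

end
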